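import Literature.NumberTheory.Automorphic.SmoothedAutomorphicForms
import Literature.NumberTheory.Automorphic.AdelicFundamentalDomain
import HarnessLib

/-!
# Smoothed cuspidal `L²`-classes are continuous cusp forms

Trunk `AutomorphicAxiomatic` (G19), topic `NumberTheory/Automorphic`; namespace `Literature.Automorphic`.
Sequel to `SmoothedAutomorphicForms` (brick (S) of the Jacquet–Shalika programme of
`InvariantMeasureDomination`, towards `StandardLFunctionData.multipliable_L` for `GL_2` without
Rankin–Selberg theory). There the smoothing `S_η f (x) = ∫ η(g) f(g⁻¹ • x) dg` of an `L²`
automorphic form was shown to be continuous, of the same level and with the same Hecke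
eigenvalues. Here we prove that it is **pointwise cuspidal** when `f` lies in the cuspidal
subspace `L²_cusp = closure (image of the continuous cusp forms)` (`GLnCuspidalSpectrum`):

* `exists_norm_orbitalSmoothing_smul_le` (abstract `G ↷ X`, Mathlib + `InvariantMeasureDomination`)
  — **local uniform bound**: for compact `Θ ⊆ G` and `η ∈ C_c(G)`,
  `‖S_η f (θ • x₀)‖ ≤ C ‖f‖_{L¹}` for all `θ ∈ Θ`; `orbitalSmoothing_sub` (pointwise additivity);
  `exists_norm_smoothedForm_le`, `smoothedForm_sub` — the same for `L²(GL_n(K) A_G \ GL_n(𝔸_K))`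
  (`‖f‖_{L¹} ≤ μ(X)^{1/2} ‖f‖_{L²}`, `integral_norm_le_measure_univ_rpow_mul_norm`), using that
  smoothing does not see null modifications (`orbitalSmoothing_adelicHaar_congr_ae`).
* `setIntegral_orbitalSmoothing_unipotent_eq_zero` — smoothing a *continuous* cusp form keeps the
  constant terms along the block unipotent radicals `𝔫_k` zero on the block fundamental domain
  `𝓕₀ = blockFundamentalDomain` of `AdelicFundamentalDomain` (Fubini on `supp η × 𝓕₀`; the joint
  integrand is continuous and, by `𝔫_k(K)`-periodicity, bounded).
* `setIntegral_smoothedForm_unipotent_eq_zero` — the same for every `f ∈ L²_cusp`: the functional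
  `f ↦ ∫_{𝓕₀} S_η f (x (1 + X)) dX` is bounded on `L²` (local uniform bound on the compact
  `x (1 + closure 𝓕₀)`) and vanishes on the dense image of the cusp forms.
* `constantTermVanishes_smoothedForm` — hence `ConstantTermVanishes n K (S_η f) k` for all
  `0 < k < n` (every Haar measure, every measurable fundamental domain:
  `IsAddFundamentalDomain.setIntegral_eq` transports from `𝓕₀`), and
  `isContinuousCuspForm_smoothedForm` — **`S_η f` is a continuous cusp form** for `f ∈ L²_cusp`.

Also: `continuous_glUnipotent_ofAdd`, `continuous_toAutomorphicQuotient_mul_glUnipotent`,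
`rationalBlock_countable`, `isOpenMap_smul_automorphicQuotient`, `integrable_smul_comp_inv_smul`.
All statements are proved; folklore (Borel–Jacquet, Corvallis (1979), §4.4–4.6; Godement–Jacquet,
LNM 260, §10; Mathlib `MeasureTheory.IsFundamentalDomain`).
-/

noncomputable section

open MeasureTheory Measure Set Filter Topology IsDedekindDomain NumberField
open scoped ENNReal Pointwise

namespace Literature.NumberTheory.Automorphic

/-! ### Local uniform bounds for orbital smoothings -/

section LocalBound

variable {G X : Type*} [Group G] [TopologicalSpace G] [IsTopologicalGroup G]
  [MeasurableSpace G] [BorelSpace G]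
  [MulAction G X] [TopologicalSpace X] [MeasurableSpace X] [OpensMeasurableSpace X]
  [MeasurableSMul₂ G X]
  {𝕜 : Type*} [RCLike 𝕜] {E' : Type*} [NormedAddCommGroup E'] [NormedSpace 𝕜 E']
  [NormedSpace ℝ E']
  (μ : Measure X) (ν : Measure G) [IsFiniteMeasure μ] [SFinite ν] [SMulInvariantMeasure G X μ]
  [μ.IsOpenPosMeasure] [ν.IsMulLeftInvariant] [IsFiniteMeasureOnCompacts ν]

omit [NormedSpace ℝ E'] in
/-- At a point `x` with open orbit map, the integrand `g ↦ η(g) f(g⁻¹ • x)` of the orbital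
smoothing of an integrable `f` by a weight `η ∈ C_c(G)` is integrable on `G` (domination on the
compact support of `η`). [folklore] -/
theorem integrable_smul_comp_inv_smul [LocallyCompactSpace G] {x : X}
    (hx : IsOpenMap fun g : G => g • x) {η : G → 𝕜} (hη : Continuous η)
    (hηs : HasCompactSupport η) {f : X → E'} (hf : Integrable f μ) :
    Integrable (fun g : G => η g • f (g⁻¹ • x)) ν := by
  set D : Set G := tsupport η with hD
  have hDc : IsCompact D := hηs
  have hDm : MeasurableSet D := (isClosed_tsupport η).measurableSet
  obtain ⟨C, hC, hdom⟩ := exists_measure_inter_invOrbitPreimage_le μ ν hx hDc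
  have hfD : IntegrableOn (fun g : G => f (g⁻¹ • x)) D ν :=
    Integrable.comp_inv_smul μ ν hC hdom hf
  obtain ⟨M, hM⟩ := hη.bounded_above_of_compact_support hηs
  have h1 : IntegrableOn (fun g : G => η g • f (g⁻¹ • x)) D ν := by
    refine Integrable.mono' (hfD.norm.const_mul M)
      (hη.aestronglyMeasurable.restrict.smul hfD.aestronglyMeasurable) ?_
    exact Eventually.of_forall fun g => by
      rw [_root_.norm_smul]; exact mul_le_mul_of_nonneg_right (hM g) (norm_nonneg _)
  have h2 : (fun g : G => η g • f (g⁻¹ • x)) = D.indicator (fun g => η g • f (g⁻¹ • x)) := by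
    funext g
    by_cases hg : g ∈ D
    · rw [indicator_of_mem hg]
    · rw [indicator_of_notMem hg, image_eq_zero_of_notMem_tsupport hg, zero_smul]
  rw [h2]
  exact h1.integrable_indicator hDm

/-- Orbital smoothing is additive in `f` at points with open orbit map:
`S_η (f - f') (x) = S_η f (x) - S_η f' (x)` for integrable `f, f'`. [folklore] -/
theorem orbitalSmoothing_sub [LocallyCompactSpace G] {x : X} (hx : IsOpenMap fun g : G => g • x)
    {η : G → 𝕜} (hη : Continuous η) (hηs : HasCompactSupport η) {f f' : X → E'}
    (hf : Integrable f μ) (hf' : Integrable f' μ) :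
    orbitalSmoothing ν η (f - f') x = orbitalSmoothing ν η f x - orbitalSmoothing ν η f' x := by
  unfold orbitalSmoothing
  rw [← integral_sub (integrable_smul_comp_inv_smul μ ν hx hη hηs hf)
    (integrable_smul_comp_inv_smul μ ν hx hη hηs hf')]
  congr 1 with g
  rw [Pi.sub_apply, smul_sub]

/-- **Local uniform bound for orbital smoothings.** For a compact `Θ ⊆ G` and `η ∈ C_c(G)` there is
`C ≥ 0` with `‖S_η f (θ • x₀)‖ ≤ C ‖f‖_{L¹(μ)}` for all `θ ∈ Θ` and all integrable (strongly
measurable) `f` — on compact pieces of an open orbit, smoothing is a bounded operator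
`L¹(μ) → C_b`. (Substituting `g = θ h`, the integrand lives on the compact `Θ⁻¹ · supp η`, where
orbit integrals are dominated by `μ`.) [folklore] -/
theorem exists_norm_orbitalSmoothing_smul_le [LocallyCompactSpace G] {x₀ : X}
    (hx₀ : IsOpenMap fun g : G => g • x₀) {Θ : Set G} (hΘ : IsCompact Θ)
    {η : G → 𝕜} (hη : Continuous η) (hηs : HasCompactSupport η) :
    ∃ C : ℝ, 0 ≤ C ∧ ∀ f : X → E', StronglyMeasurable f → Integrable f μ → ∀ θ ∈ Θ,
      ‖orbitalSmoothing ν η f (θ • x₀)‖ ≤ C * ∫ x, ‖f x‖ ∂μ := by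
  obtain ⟨M, hM⟩ := hη.bounded_above_of_compact_support hηs
  set D : Set G := closure (Θ⁻¹ * tsupport η) with hD
  have hDc : IsCompact D := (hΘ.inv.mul hηs).closure
  have hDm : MeasurableSet D := isClosed_closure.measurableSet
  obtain ⟨C, hC, hdom⟩ := exists_measure_inter_invOrbitPreimage_le μ ν hx₀ hDc
  have hM0 : 0 ≤ M := (norm_nonneg _).trans (hM 1)
  refine ⟨M * C.toReal, mul_nonneg hM0 ENNReal.toReal_nonneg, fun f hfm hf θ hθ => ?_⟩
  have hsupp : ∀ h, η (θ * h) ≠ 0 → h ∈ D := fun h hh =>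
    subset_closure ⟨θ⁻¹, Set.inv_mem_inv.2 hθ, θ * h,
      subset_tsupport _ (Function.mem_support.2 hh), by simp⟩
  rw [orbitalSmoothing_smul]
  have hind : (fun h => η (θ * h) • f (h⁻¹ • x₀)) =
      D.indicator (fun h => η (θ * h) • f (h⁻¹ • x₀)) := by
    funext h
    by_cases hh : h ∈ D
    · rw [indicator_of_mem hh]
    · rw [indicator_of_notMem hh]
      have : η (θ * h) = 0 := by by_contra hne; exact hh (hsupp h hne)
      rw [this, zero_smul]
  rw [hind, integral_indicator hDm]
  have hfD : IntegrableOn (fun g : G => f (g⁻¹ • x₀)) D ν :=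
    Integrable.comp_inv_smul μ ν hC hdom hf
  calc ‖∫ h in D, η (θ * h) • f (h⁻¹ • x₀) ∂ν‖
      ≤ ∫ h in D, M * ‖f (h⁻¹ • x₀)‖ ∂ν := by
        refine norm_integral_le_of_norm_le (hfD.norm.const_mul M)
          (Eventually.of_forall fun h => ?_)
        rw [_root_.norm_smul]
        exact mul_le_mul_of_nonneg_right (hM _) (norm_nonneg _)
    _ = M * ∫ h in D, ‖f (h⁻¹ • x₀)‖ ∂ν := integral_const_mul _ _
    _ ≤ M * (C.toReal * ∫ x, ‖f x‖ ∂μ) := by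
        refine mul_le_mul_of_nonneg_left ?_ hM0
        have := integral_smul_inv_smul_le μ ν hC hdom (F := fun x => ‖f x‖)
          hfm.norm.measurable (fun _ => norm_nonneg _) hf.norm (1 : G)
        simpa only [one_smul] using this
    _ = M * C.toReal * ∫ x, ‖f x‖ ∂μ := (mul_assoc _ _ _).symm

end LocalBound

/-! ### The `L¹`-norm of an `L²`-class on a finite measure space -/

section LoneLtwo

variable {X : Type*} [MeasurableSpace X] {μ : Measure X} [IsFiniteMeasure μ]
  {E : Type*} [NormedAddCommGroup E]

/-- `‖f‖_{L¹} ≤ μ(X)^{1/2} ‖f‖_{L²}` for `f ∈ L²` of a finite measure (Cauchy–Schwarz; Mathlib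
`eLpNorm_le_eLpNorm_mul_rpow_measure_univ`). [folklore] -/
theorem integral_norm_le_measure_univ_rpow_mul_norm (f : Lp E 2 μ) :
    ∫ x, ‖f x‖ ∂μ ≤ (μ Set.univ).toReal ^ (1 / 2 : ℝ) * ‖f‖ := by
  have h1 : eLpNorm f 1 μ ≤ eLpNorm f 2 μ * μ Set.univ ^ (1 / (1 : ℝ≥0∞).toReal - 1 / (2 : ℝ≥0∞).toReal) :=
    eLpNorm_le_eLpNorm_mul_rpow_measure_univ (by norm_num) (Lp.aestronglyMeasurable f)
  have hexp : (1 / (1 : ℝ≥0∞).toReal - 1 / (2 : ℝ≥0∞).toReal : ℝ) = 1 / 2 := by norm_num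
  rw [hexp] at h1
  have hint : ∫ x, ‖f x‖ ∂μ = (eLpNorm f 1 μ).toReal := by
    rw [integral_norm_eq_lintegral_enorm (Lp.aestronglyMeasurable f), eLpNorm_one_eq_lintegral_enorm]
  have h2 : (eLpNorm f 2 μ).toReal = ‖f‖ := (Lp.norm_def f).symm
  rw [hint, ← h2, mul_comm]
  have hfin : eLpNorm f 2 μ * μ Set.univ ^ (1 / 2 : ℝ) ≠ ∞ :=
    ENNReal.mul_ne_top (Lp.eLpNorm_ne_top f)
      (ENNReal.rpow_ne_top_of_nonneg (by norm_num) (measure_ne_top μ _))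
  have := ENNReal.toReal_mono hfin h1
  rwa [ENNReal.toReal_mul, ← ENNReal.toReal_rpow] at this

end LoneLtwo

/-! ### Smoothed `L²`-forms: differences and local bounds -/

section Adelic

variable {n : ℕ} {K : Type} [Field K] [NumberField K]
  {μ : Measure (AdelicGroupData.gl n K).automorphicQuotient}
  [(AdelicGroupData.gl n K).IsAutomorphicMeasure μ]

attribute [local instance] adelicBorel borelSpace_adelic locallyCompactSpace_adelic
  secondCountableTopology_gl_adelic

variable (n K) in
/-- Every orbit map `g ↦ g • x` of the automorphic quotient is open. [folklore] -/
theorem isOpenMap_smul_automorphicQuotient (x : (AdelicGroupData.gl n K).automorphicQuotient) :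
    IsOpenMap fun g : (AdelicGroupData.gl n K).Adelic => g • x :=
  isOpenMap_smul_quotient _ _

/-- The smoothing of an `L²`-class at a point does not depend on the representative: if
`f = f'` a.e. then `S_η f (x) = S_η f' (x)` for every `x` (null sets pull back to null sets along
the open orbits of the `σ`-compact group `GL_n(𝔸_K)`). [folklore] -/
theorem orbitalSmoothing_adelicHaar_congr_ae (η : (AdelicGroupData.gl n K).Adelic → ℂ)
    {f f' : (AdelicGroupData.gl n K).automorphicQuotient → ℂ} (h : f =ᵐ[μ] f')
    (x : (AdelicGroupData.gl n K).automorphicQuotient) :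
    orbitalSmoothing (adelicHaar n K) η f x = orbitalSmoothing (adelicHaar n K) η f' x := by
  obtain ⟨θ, rfl⟩ := surjective_smul_basePoint n K x
  exact orbitalSmoothing_congr_ae (adelicHaar n K) η h fun E hE hE0 =>
    measure_invOrbitPreimage_eq_zero μ (adelicHaar n K) (isOpenMap_smul_basePoint n K) θ hE hE0

/-- **Pointwise additivity of smoothing on `L²`**: `S_η (f - f') (x) = S_η f (x) - S_η f' (x)` at
every point (the `L²`-subtraction is pointwise only a.e., but smoothing does not see null
modifications). [folklore] -/
theorem smoothedForm_sub {η : (AdelicGroupData.gl n K).Adelic → ℝ} (hη : Continuous η)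
    (hηs : HasCompactSupport η) (f f' : (AdelicGroupData.gl n K).L2 μ)
    (x : (AdelicGroupData.gl n K).automorphicQuotient) :
    smoothedForm η (f - f') x = smoothedForm η f x - smoothedForm η f' x := by
  have hηc : Continuous fun g => (η g : ℂ) := Complex.continuous_ofReal.comp hη
  have hηsc : HasCompactSupport fun g => (η g : ℂ) := hηs.comp_left Complex.ofReal_zero
  unfold smoothedForm
  rw [orbitalSmoothing_adelicHaar_congr_ae (μ := μ) _ (Lp.coeFn_sub f f') x]
  exact orbitalSmoothing_sub μ (adelicHaar n K) (isOpenMap_smul_automorphicQuotient n K x)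
    hηc hηsc (integrable_coeFn_L2 μ f) (integrable_coeFn_L2 μ f')

/-- **Local uniform bound for smoothed `L²`-forms**: for compact `Θ ⊆ GL_n(𝔸_K)` and
`η ∈ C_c(GL_n(𝔸_K))` there is `C ≥ 0` with `‖S_η f (θ · x₀)‖ ≤ C ‖f‖_{L²}` for all `θ ∈ Θ` and
all `f ∈ L²(μ)`. [folklore] -/
theorem exists_norm_smoothedForm_le {η : (AdelicGroupData.gl n K).Adelic → ℝ} (hη : Continuous η)
    (hηs : HasCompactSupport η) {Θ : Set (AdelicGroupData.gl n K).Adelic} (hΘ : IsCompact Θ) :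
    ∃ C : ℝ, 0 ≤ C ∧ ∀ (f : (AdelicGroupData.gl n K).L2 μ), ∀ θ ∈ Θ,
      ‖smoothedForm η f (θ • basePoint n K)‖ ≤ C * ‖f‖ := by
  have hηc : Continuous fun g => (η g : ℂ) := Complex.continuous_ofReal.comp hη
  have hηsc : HasCompactSupport fun g => (η g : ℂ) := hηs.comp_left Complex.ofReal_zero
  obtain ⟨C, hC0, hC⟩ := exists_norm_orbitalSmoothing_smul_le (E' := ℂ) μ (adelicHaar n K)
    (isOpenMap_smul_basePoint n K) hΘ hηc hηsc
  refine ⟨C * (μ Set.univ).toReal ^ (1 / 2 : ℝ), by positivity, fun f θ hθ => ?_⟩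
  calc ‖smoothedForm η f (θ • basePoint n K)‖
      ≤ C * ∫ x, ‖(f : (AdelicGroupData.gl n K).automorphicQuotient → ℂ) x‖ ∂μ :=
        hC _ (Lp.stronglyMeasurable f) (integrable_coeFn_L2 μ f) θ hθ
    _ ≤ C * ((μ Set.univ).toReal ^ (1 / 2 : ℝ) * ‖f‖) :=
        mul_le_mul_of_nonneg_left (integral_norm_le_measure_univ_rpow_mul_norm f) hC0
    _ = C * (μ Set.univ).toReal ^ (1 / 2 : ℝ) * ‖f‖ := (mul_assoc _ _ _).symm

end Adelic


/-! ### Continuity of the unipotent block embedding; countability of the rational block -/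

section Unipotent

variable {n k : ℕ} {K : Type} [Field K] [NumberField K]

/-- `X ↦ 1 + X : 𝔫_k(𝔸_K) → GL_n(𝔸_K)` is continuous for the units topology (both `1 + X` and the
inverse `1 - X` depend continuously on `X`). [folklore] -/
theorem continuous_glUnipotent_ofAdd :
    Continuous fun X : blockNilpotent n k (AdeleRing (𝓞 K) K) =>
      glUnipotent n k K (Multiplicative.ofAdd X) := by
  refine Units.continuous_iff.2 ⟨?_, ?_⟩
  · exact continuous_const.add continuous_subtype_val
  · exact continuous_const.sub continuous_subtype_val

/-- `(y, X) ↦ y (1 + X) · x₀ : GL_n(𝔸_K) × 𝔫_k(𝔸_K) → GL_n(𝔸_K) ⧸ A_G GL_n(K)` is continuous.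
[folklore] -/
theorem continuous_toAutomorphicQuotient_mul_glUnipotent :
    Continuous fun p : (AdelicGroupData.gl n K).Adelic × blockNilpotent n k (AdeleRing (𝓞 K) K) =>
      (AdelicGroupData.gl n K).toAutomorphicQuotient
        (p.1 * glUnipotent n k K (Multiplicative.ofAdd p.2)) :=
  (AdelicGroupData.gl n K).continuous_toAutomorphicQuotient.comp
    (continuous_fst.mul (continuous_glUnipotent_ofAdd.comp continuous_snd))

/-- The rational block `𝔫_k(K)` is countable (its entries lie in the countable field `K`).
[folklore] -/
theorem rationalBlock_countable : Countable (rationalBlock n k K) := by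
  haveI : Countable K := NumberField.countable' (K := K)
  have h : ∀ γ : rationalBlock n k K, ∃ x : Fin n → Fin n → K, ∀ i j,
      algebraMap K (AdeleRing (𝓞 K) K) (x i j) =
        ((γ : blockNilpotent n k (AdeleRing (𝓞 K) K)) :
          Matrix (Fin n) (Fin n) (AdeleRing (𝓞 K) K)) i j := by
    intro γ
    have hγ := mem_rationalBlock_iff.1 γ.2
    choose x hx using fun i j => RingHom.mem_range.1 (hγ i j)
    exact ⟨x, hx⟩
  choose x hx using h
  refine Function.Injective.countable (f := x) fun γ γ' hγ => ?_
  refine Subtype.ext (Subtype.ext (Matrix.ext fun i j => ?_))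
  rw [← hx γ i j, ← hx γ' i j, hγ]

end Unipotent

/-! ### Smoothed cuspidal `L²`-classes have vanishing constant terms -/

section Cuspidal

variable {n : ℕ} {K : Type} [Field K] [NumberField K]
  {μ : Measure (AdelicGroupData.gl n K).automorphicQuotient}
  [(AdelicGroupData.gl n K).IsAutomorphicMeasure μ]

attribute [local instance] adelicBorel borelSpace_adelic locallyCompactSpace_adelic
  secondCountableTopology_gl_adelic

/-- **Smoothing preserves cuspidality of continuous cusp forms, on the block fundamental domain.**
For a continuous `φ` whose `k`-th constant term vanishes and a weight `η ∈ C_c(GL_n(𝔸_K))`,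
`∫_{𝓕₀} S_η φ (x (1 + X)) dν(X) = 0` for every additive Haar measure `ν` on `𝔫_k(𝔸_K)` and every
`x`, where `𝓕₀ = blockFundamentalDomain` (Fubini over `supp η × 𝓕₀`: the joint integrand is
continuous, and bounded by periodicity in `X` and relative compactness of `𝓕₀`; the inner
`X`-integral is the constant term of `φ` at `g⁻¹ x`). [folklore] -/
theorem setIntegral_orbitalSmoothing_unipotent_eq_zero {k : ℕ}
    {φ : (AdelicGroupData.gl n K).automorphicQuotient → ℂ} (hφc : Continuous φ)
    (hφ : ConstantTermVanishes n K φ k)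
    {η : (AdelicGroupData.gl n K).Adelic → ℝ} (hη : Continuous η) (hηs : HasCompactSupport η)
    (ν : Measure (blockNilpotent n k (AdeleRing (𝓞 K) K))) [ν.IsAddHaarMeasure]
    (x : (AdelicGroupData.gl n K).Adelic) :
    ∫ X in blockFundamentalDomain n k K,
      orbitalSmoothing (adelicHaar n K) (fun g => (η g : ℂ)) φ
        ((AdelicGroupData.gl n K).toAutomorphicQuotient
          (x * glUnipotent n k K (Multiplicative.ofAdd X))) ∂ν = 0 := by
  set 𝓕 := blockFundamentalDomain n k K with h𝓕def
  -- the joint integrand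
  set F : blockNilpotent n k (AdeleRing (𝓞 K) K) → (AdelicGroupData.gl n K).Adelic → ℂ :=
    fun X g => (η g : ℂ) • φ ((AdelicGroupData.gl n K).toAutomorphicQuotient
      (g⁻¹ * x * glUnipotent n k K (Multiplicative.ofAdd X))) with hFdef
  have hF_eq : ∀ X, orbitalSmoothing (adelicHaar n K) (fun g => (η g : ℂ)) φ
      ((AdelicGroupData.gl n K).toAutomorphicQuotient
        (x * glUnipotent n k K (Multiplicative.ofAdd X))) = ∫ g, F X g ∂(adelicHaar n K) := by
    intro X
    unfold orbitalSmoothing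
    congr 1 with g
    simp only [hFdef, AdelicGroupData.smul_toAutomorphicQuotient, mul_assoc]
  simp_rw [hF_eq]
  -- periodicity in `X`
  have hper : ∀ (γ : rationalBlock n k K) (X : blockNilpotent n k (AdeleRing (𝓞 K) K))
      (y : (AdelicGroupData.gl n K).Adelic),
      φ ((AdelicGroupData.gl n K).toAutomorphicQuotient
        (y * glUnipotent n k K (Multiplicative.ofAdd (γ +ᵥ X)))) =
      φ ((AdelicGroupData.gl n K).toAutomorphicQuotient
        (y * glUnipotent n k K (Multiplicative.ofAdd X))) :=
    fun γ X y => toAutomorphicQuotient_mul_glUnipotent_vadd φ y γ X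
  -- continuity of the joint integrand
  have hcontφ : Continuous fun p : blockNilpotent n k (AdeleRing (𝓞 K) K) ×
      (AdelicGroupData.gl n K).Adelic => φ ((AdelicGroupData.gl n K).toAutomorphicQuotient
        (p.2⁻¹ * x * glUnipotent n k K (Multiplicative.ofAdd p.1))) := by
    refine hφc.comp ((AdelicGroupData.gl n K).continuous_toAutomorphicQuotient.comp ?_)
    exact ((continuous_snd.inv).mul continuous_const).mul
      (continuous_glUnipotent_ofAdd.comp continuous_fst)
  have hcontF : Continuous (Function.uncurry F) :=
    ((Complex.continuous_ofReal.comp hη).comp continuous_snd).smul hcontφ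
  -- a global bound: periodicity reduces to the compact `closure 𝓕 × tsupport η`
  set S := tsupport η with hSdef
  have hSc : IsCompact S := hηs
  have h𝓕c : IsCompact (closure 𝓕) := isCompact_closure_blockFundamentalDomain n k K
  obtain ⟨M, hM⟩ : ∃ M, ∀ p ∈ closure 𝓕 ×ˢ S, ‖Function.uncurry F p‖ ≤ M :=
    (h𝓕c.prod hSc).exists_bound_of_continuousOn hcontF.continuousOn
  have hbound : ∀ X g, ‖F X g‖ ≤ max M 0 := by
    intro X g
    by_cases hg : g ∈ S
    · obtain ⟨γ, hγ⟩ := (existsUnique_vadd_mem_blockFundamentalDomain n k K X).exists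
      have : F X g = F (γ +ᵥ X) g := by
        simp only [hFdef, hper γ X (g⁻¹ * x)]
      rw [this]
      exact (hM (γ +ᵥ X, g) ⟨subset_closure hγ, hg⟩).trans (le_max_left _ _)
    · have : F X g = 0 := by
        simp only [hFdef, image_eq_zero_of_notMem_tsupport hg, Complex.ofReal_zero, zero_smul]
      rw [this, norm_zero]
      exact le_max_right _ _
  -- integrability on the product `(ν|_𝓕) × Haar`
  have h𝓕fin : ν 𝓕 < ⊤ := measure_blockFundamentalDomain_lt_top n k K ν
  haveI : IsFiniteMeasure (ν.restrict 𝓕) := ⟨by rwa [Measure.restrict_apply_univ]⟩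
  have hint : Integrable (Function.uncurry F) ((ν.restrict 𝓕).prod (adelicHaar n K)) := by
    have hsupp : ∀ p ∉ (Set.univ : Set (blockNilpotent n k (AdeleRing (𝓞 K) K))) ×ˢ S,
        Function.uncurry F p = 0 := by
      rintro ⟨X, g⟩ hp
      have hg : g ∉ S := fun hg => hp ⟨Set.mem_univ _, hg⟩
      simp only [Function.uncurry_apply_pair, hFdef, image_eq_zero_of_notMem_tsupport hg,
        Complex.ofReal_zero, zero_smul]
    refine IntegrableOn.integrable_of_forall_notMem_eq_zero ?_ hsupp
    refine Measure.integrableOn_of_bounded (M := max M 0) ?_ hcontF.aestronglyMeasurable ?_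
    · rw [Measure.prod_prod, Measure.restrict_apply_univ]
      exact ENNReal.mul_ne_top h𝓕fin.ne hSc.measure_lt_top.ne
    · exact Eventually.of_forall fun p => hbound p.1 p.2
  rw [integral_integral_swap hint]
  -- the inner integral is `η g` times the constant term of `φ` at `g⁻¹ x`
  have hinner : ∀ g, ∫ X in 𝓕, F X g ∂ν = 0 := by
    intro g
    simp only [hFdef]
    rw [integral_smul, (hφ ν 𝓕 (isAddFundamentalDomain_blockFundamentalDomain n k K ν)
      (g⁻¹ * x)).2, smul_zero]
  have hfun : (fun g => ∫ X in 𝓕, F X g ∂ν) = fun _ => (0 : ℂ) := funext hinner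
  rw [hfun]
  exact integral_zero _ _

/-- **Smoothings of cuspidal `L²`-classes are cuspidal on the block fundamental domain.** For
`f ∈ L²_cusp` (the closure of the image of the continuous cusp forms) and `η ∈ C_c(GL_n(𝔸_K))`,
`∫_{𝓕₀} S_η f (x (1 + X)) dν(X) = 0`. The functional `f ↦ ∫_{𝓕₀} S_η f (x(1+X)) dν` is bounded on
`L²` (local uniform bound for smoothings on the compact `x (1 + closure 𝓕₀)`) and vanishes on the
image of the cusp forms (`setIntegral_orbitalSmoothing_unipotent_eq_zero`; smoothing does not see
the passage to the `L²`-class), hence on its closure. [folklore] -/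
theorem setIntegral_smoothedForm_unipotent_eq_zero {k : ℕ} (hk : 0 < k) (hkn : k < n)
    {η : (AdelicGroupData.gl n K).Adelic → ℝ} (hη : Continuous η) (hηs : HasCompactSupport η)
    {f : (AdelicGroupData.gl n K).L2 μ} (hf : f ∈ cuspidalSubspace n K μ)
    (ν : Measure (blockNilpotent n k (AdeleRing (𝓞 K) K))) [ν.IsAddHaarMeasure]
    (x : (AdelicGroupData.gl n K).Adelic) :
    ∫ X in blockFundamentalDomain n k K, smoothedForm η f
      ((AdelicGroupData.gl n K).toAutomorphicQuotient
        (x * glUnipotent n k K (Multiplicative.ofAdd X))) ∂ν = 0 := by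
  set 𝓕 := blockFundamentalDomain n k K with h𝓕def
  -- the points `x (1 + X)` of the quotient (a `let`, not `set`: abstracting a `fun` is too slow)
  let pt : blockNilpotent n k (AdeleRing (𝓞 K) K) → (AdelicGroupData.gl n K).automorphicQuotient :=
    fun X => (AdelicGroupData.gl n K).toAutomorphicQuotient
      (x * glUnipotent n k K (Multiplicative.ofAdd X))
  have hptc : Continuous pt := by
    refine (AdelicGroupData.gl n K).continuous_toAutomorphicQuotient.comp ?_
    exact continuous_const.mul continuous_glUnipotent_ofAdd
  have hpt_eq : ∀ X, pt X = (x * glUnipotent n k K (Multiplicative.ofAdd X)) • basePoint n K :=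
    fun X => (smul_basePoint n K _).symm
  -- the compact piece of `GL_n(𝔸_K)` and the local uniform bound
  have hΘ : IsCompact ((fun X : blockNilpotent n k (AdeleRing (𝓞 K) K) =>
      x * glUnipotent n k K (Multiplicative.ofAdd X)) '' closure 𝓕) :=
    (isCompact_closure_blockFundamentalDomain n k K).image
      (continuous_const.mul continuous_glUnipotent_ofAdd)
  obtain ⟨C, hC0, hC⟩ := exists_norm_smoothedForm_le (μ := μ) hη hηs hΘ
  have hptbd : ∀ (h : (AdelicGroupData.gl n K).L2 μ), ∀ X ∈ 𝓕,
      ‖smoothedForm η h (pt X)‖ ≤ C * ‖h‖ := fun h X hX => by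
    rw [hpt_eq]
    exact hC h _ ⟨X, subset_closure hX, rfl⟩
  have h𝓕fin : ν 𝓕 < ⊤ := measure_blockFundamentalDomain_lt_top n k K ν
  have h𝓕m : MeasurableSet 𝓕 := measurableSet_blockFundamentalDomain n k K
  -- the functional `Λ h = ∫_𝓕 S_η h (x (1 + X)) dν` and its properties
  let Λ : (AdelicGroupData.gl n K).L2 μ → ℂ := fun h => ∫ X in 𝓕, smoothedForm η h (pt X) ∂ν
  have hInt : ∀ h : (AdelicGroupData.gl n K).L2 μ,
      IntegrableOn (fun X => smoothedForm η h (pt X)) 𝓕 ν := fun h =>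
    Measure.integrableOn_of_bounded (M := C * ‖h‖) h𝓕fin.ne
      ((continuous_smoothedForm hη hηs h).comp hptc).aestronglyMeasurable
      ((ae_restrict_iff' h𝓕m).2 (Eventually.of_forall (hptbd h)))
  have hΛbd : ∀ h, ‖Λ h‖ ≤ C * ‖h‖ * (ν 𝓕).toReal := fun h =>
    norm_setIntegral_le_of_norm_le_const h𝓕fin (hptbd h)
  have hΛsub : ∀ h h', Λ h - Λ h' = Λ (h - h') := fun h h' => by
    simp only [Λ]
    rw [← integral_sub (hInt h) (hInt h')]
    congr 1 with X
    rw [smoothedForm_sub hη hηs]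
  have hΛrange : ∀ h ∈ LinearMap.range (cuspFormsToLp n K μ), Λ h = 0 := by
    rintro _ ⟨φ, rfl⟩
    have hφ := φ.2
    simp only [Λ]
    have hae : ((cuspFormsToLp n K μ φ : (AdelicGroupData.gl n K).L2 μ) :
        (AdelicGroupData.gl n K).automorphicQuotient → ℂ) =ᵐ[μ]
        (φ : (AdelicGroupData.gl n K).automorphicQuotient → ℂ) := by
      rw [cuspFormsToLp_apply]
      exact MemLp.coeFn_toLp _
    have hrepl : ∀ X, smoothedForm η (cuspFormsToLp n K μ φ) (pt X) =
        orbitalSmoothing (adelicHaar n K) (fun g => (η g : ℂ))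
          (φ : (AdelicGroupData.gl n K).automorphicQuotient → ℂ) (pt X) := fun X =>
      orbitalSmoothing_adelicHaar_congr_ae (μ := μ) _ hae _
    simp_rw [hrepl]
    exact setIntegral_orbitalSmoothing_unipotent_eq_zero hφ.1 (hφ.2.2 k hk hkn) hη hηs ν x
  -- closure
  have hfc : f ∈ closure (LinearMap.range (cuspFormsToLp n K μ) :
      Set ((AdelicGroupData.gl n K).L2 μ)) := by
    rw [← Submodule.topologicalClosure_coe]
    exact hf
  have key : ∀ ε : ℝ, 0 < ε → ‖Λ f‖ ≤ ε := by
    intro ε hε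
    set D := C * (ν 𝓕).toReal + 1 with hD
    have hDpos : 0 < D := by positivity
    obtain ⟨h, hh, hdist⟩ := Metric.mem_closure_iff.1 hfc (ε / D) (div_pos hε hDpos)
    rw [dist_eq_norm] at hdist
    have h1 : Λ f = Λ (f - h) := by rw [← hΛsub, hΛrange h hh, sub_zero]
    rw [h1]
    calc ‖Λ (f - h)‖ ≤ C * ‖f - h‖ * (ν 𝓕).toReal := hΛbd _
      _ = C * (ν 𝓕).toReal * ‖f - h‖ := by ring
      _ ≤ D * (ε / D) := by
          refine mul_le_mul ?_ hdist.le (norm_nonneg _) hDpos.le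
          rw [hD]; linarith [mul_nonneg hC0 (ENNReal.toReal_nonneg : 0 ≤ (ν 𝓕).toReal)]
      _ = ε := mul_div_cancel₀ ε hDpos.ne'
  have : ‖Λ f‖ ≤ 0 := le_of_forall_pos_le_add fun ε hε => by rw [zero_add]; exact key ε hε
  exact norm_le_zero_iff.1 this

/-- **Smoothed cuspidal `L²`-classes are cuspidal (all constant terms vanish, for every Haar
measure and every fundamental domain).** The integrand `X ↦ S_η f (x (1 + X))` is continuous and
`𝔫_k(K)`-periodic, hence bounded (by its values on the relatively compact `𝓕₀`), so it is
integrable on any fundamental domain (all have the finite measure of `𝓕₀`), and its integral there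
equals the one over `𝓕₀` (Mathlib `IsAddFundamentalDomain.setIntegral_eq`), which vanishes.
[folklore] -/
theorem constantTermVanishes_smoothedForm {k : ℕ} (hk : 0 < k) (hkn : k < n)
    {η : (AdelicGroupData.gl n K).Adelic → ℝ} (hη : Continuous η) (hηs : HasCompactSupport η)
    {f : (AdelicGroupData.gl n K).L2 μ} (hf : f ∈ cuspidalSubspace n K μ) :
    ConstantTermVanishes n K (smoothedForm η f) k := by
  intro ν _ 𝓕 h𝓕 x
  haveI : Countable (rationalBlock n k K) := rationalBlock_countable
  set 𝓕₀ := blockFundamentalDomain n k K with h𝓕₀def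
  have h𝓕₀ : IsAddFundamentalDomain (rationalBlock n k K) 𝓕₀ ν :=
    isAddFundamentalDomain_blockFundamentalDomain n k K ν
  -- the integrand (a `let`, not `set`)
  let I : blockNilpotent n k (AdeleRing (𝓞 K) K) → ℂ := fun X => smoothedForm η f
    ((AdelicGroupData.gl n K).toAutomorphicQuotient
      (x * glUnipotent n k K (Multiplicative.ofAdd X)))
  have hIc : Continuous I := by
    refine (continuous_smoothedForm hη hηs f).comp ?_
    refine (AdelicGroupData.gl n K).continuous_toAutomorphicQuotient.comp ?_
    exact continuous_const.mul continuous_glUnipotent_ofAdd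
  have hIper : ∀ (γ : rationalBlock n k K) (X : blockNilpotent n k (AdeleRing (𝓞 K) K)),
      I (γ +ᵥ X) = I X := fun γ X =>
    toAutomorphicQuotient_mul_glUnipotent_vadd (smoothedForm η f) x γ X
  -- global bound by periodicity
  obtain ⟨M, hM⟩ : ∃ M, ∀ X ∈ closure 𝓕₀, ‖I X‖ ≤ M :=
    (isCompact_closure_blockFundamentalDomain n k K).exists_bound_of_continuousOn hIc.continuousOn
  have hbd : ∀ X, ‖I X‖ ≤ M := fun X => by
    obtain ⟨γ, hγ⟩ := (existsUnique_vadd_mem_blockFundamentalDomain n k K X).exists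
    rw [← hIper γ X]
    exact hM _ (subset_closure hγ)
  have hmeas : ν 𝓕 = ν 𝓕₀ := h𝓕.measure_eq h𝓕₀
  have hfin : ν 𝓕 < ⊤ := hmeas ▸ measure_blockFundamentalDomain_lt_top n k K ν
  refine ⟨Measure.integrableOn_of_bounded (M := M) hfin.ne hIc.aestronglyMeasurable
    (Eventually.of_forall hbd), ?_⟩
  change ∫ X in 𝓕, I X ∂ν = 0
  rw [h𝓕.setIntegral_eq h𝓕₀ hIper]
  exact setIntegral_smoothedForm_unipotent_eq_zero hk hkn hη hηs hf ν x

/-- **The smoothing of a cuspidal `L²`-class is a continuous cusp form** (continuous, in `ℒ²`,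
all constant terms vanish). [folklore] -/
theorem isContinuousCuspForm_smoothedForm
    {η : (AdelicGroupData.gl n K).Adelic → ℝ} (hη : Continuous η) (hηs : HasCompactSupport η)
    {f : (AdelicGroupData.gl n K).L2 μ} (hf : f ∈ cuspidalSubspace n K μ) :
    IsContinuousCuspForm n K μ (smoothedForm η f) := by
  refine ⟨continuous_smoothedForm hη hηs f, ?_, fun k hk hkn =>
    constantTermVanishes_smoothedForm hk hkn hη hηs hf⟩
  have hae := smoothedVector_ae_eq (cuspidalSubspace n K μ) hη hηs ⟨f, hf⟩
  exact (Lp.memLp _).ae_eq hae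

end Cuspidal

end Literature.NumberTheory.Automorphic
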